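import Summits.BirchSwinnertonDyer.BirchSwinnertonDyer.Theorems.SylvesterTwoHeegnerIndexYinIndex
import HarnessLib

/-!
# Route `SylvesterTwoHeegnerIndex` (rung K7t), crux `UpperOffV0HSYPlus` (item 19804):
# K3R — «THE LAST INCH, TYPED»: the coupled 2-adic upper bound for the Hu–Shu–Yin pair on
# `p ≡ 4 (mod 9)` as ONE typed `Prop`, and its reduction to the registered residual (OFFB)

HONEST FRAMING (cell «bsd-cm», `run/shared/lean/pub/bsd-cm/`, D-0033 tranche 1a; seat `bsd-cm-two`
gen 12; planner word D316 «FILE K3R»; `--supports stmt-BirchSwinnertonDyer-19804`). NOTHING IS PROVED ABOUT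
THE CRUX HERE. The cell holds a REFEREED PAPER THEOREM («THEOREM K3», memo `MEMO-bsd-cm-two` v2.18
§64–§66, referee countersign `referee/REFEREE-ROADK-K3-G61.md`: the coupled Kolyvagin–McCallum
structure theorem at `p = 2` over the CM field `K = ℚ(ω)` for the cubic-twist pair
`(A, B) = (E_{3p²}, E_p)`, `p ≡ 4 (mod 9)`, `3 ∉ 𝔽_p^{×3}`), whose CONCLUSION in the item's own pair
currency is

  `ord₂ #Ш(E_p)[2^∞] + ord₂ #Ш(E_{3p²})[2^∞] ≤ ord₂ (#Ш_an(E_p) · #Ш_an(E_{3p²}))  (= 2·m(p))`.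

The tree has no Euler-system / Kolyvagin-class vocabulary at the generality the paper proof uses, so
the proof is NOT ported. What this file does (planner D316 (a)–(c)):

* (a) `CoupledUpperBoundAtTwoFourModNine` — K3's conclusion as a typed, fact-free, Euler-system-free
  `Prop` in ANALYTIC PAIR FORM (the `qB, qA` of `HuShuYin2019.thm14_threePart_product` /
  `…shaAnPair_mul_height_eq_two_zpow_mul_height`), i.e. the `p ≡ 4 (mod 9)` slice of the right-hand side
  of k7t-c2's `SylvesterTwoUpper.upperOfFacts_iff_pairBound`.
* (b) THE REDUCTION: granted `PublishedFactsTwoPlus`, `CoupledUpperBoundAtTwoFourModNine` is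
  EQUIVALENT to `MissingUpperBoundAt B 2` for every globally minimal `B ≅ E_p`, `p ≡ 4 (mod 9)`
  (`coupledUpperBound_iff_missingUpperBoundAt` — the «last inch» is an iff, by
  `SylvesterTwoUpper.missingUpperBoundAt_iff_pairBound`); in particular it implies VARIANT H's
  registered residual `stub_upperOffV0B_HSY` RESTRICTED to `p % 9 = 4` VERBATIM
  (`upperOffV0B_fourModNine_of_coupledUpperBound`; the stub's hypothesis `#Ш(B)[2^∞] ≠ 1` is not
  needed — K3 covers the `𝒱₀` locus too), and together with any proof of the `p % 9 = 7` half it gives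
  the whole stub (`upperOffV0B_of_residues`) and hence the crux `UpperOffV0HSYPlus` through bsd-cm-two
  g8's `SylvesterTwoYin.upperOffV0HSYPlus_of_yin_of_offV0B` (`upperOffV0HSYPlus_of_coupledUpperBound`).
  The A-side needs NO displayed hypothesis: `analyticRank A = 0` is a conjunct of the Hu–Shu–Yin fact,
  modularity gives `L(A,1) ≠ 0`, and `bsdTriple_of_hasCM_of_L_one_ne_zero` gives `#Ш(A) = #Ш_an(A)`
  (`SylvesterTwoUpper.pair_shaAn_two`).
* (c) the right side is EVEN: `ord₂(qB·qA) = 2n`, `n : ℕ`, on `p ≡ 4 (mod 9)` from the display alone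
  (x1b/two's `SylvesterTwoThmCAssembly.twoAdicPairHSY_of_heightDisplay_mod_nine_eq_four`), so under the
  facts K3's literal «`s_A + s_B ≤ 2m`» and the typed `Prop` are visibly the same statement
  (`coupledUpperBound_iff_le_two_mul`).

WHAT THIS IS NOT: not a proof of K3, of the stub, or of any case of the crux; no Euler-system
formalisation; nothing at `p ≡ 7 (mod 9)`; no registration (the planner's VARIANT I, if opened, points a
stub `PublishedFactsTwoPlus → CoupledUpperBoundAtTwoFourModNine` at the paper theorem); BSD is not
claimed for any curve. References: [HuShuYin2019] Thm 1.3/1.4, Cor 4.4, (bsd) p. 12;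
[McCallumLMS1991] §5 Thm 5.4; [GrossLMS1991] §3–§10; [BurungaleFlach2024] Thm 1.1; [Miller2011LMS]
Def 1.1; cell memo two v2.18 §57, §64–§66.
-/

set_option autoImplicit false
set_option linter.dupNamespace false

noncomputable section

open scoped Classical

open WeierstrassCurve Literature.NumberTheory.EllipticCurves
  Literature.NumberTheory.EllipticCurves.Rank1Residual.Typed
  Literature.NumberTheory.EllipticCurves.HuShuYin2019
  Summit.BirchSwinnertonDyer.Rank1Residual
  Summit.BirchSwinnertonDyer.BirchSwinnertonDyer.Theses.SylvesterTwoHeegnerIndex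
  Summit.BirchSwinnertonDyer.BirchSwinnertonDyer.Theorems

namespace Summit.BirchSwinnertonDyer.BirchSwinnertonDyer.Theorems.SylvesterTwoCoupledUpperBound

/-! ## §1 The typed conclusion of THEOREM K3 -/

/-- **K3's conclusion, typed (analytic pair form, `p ≡ 4 (mod 9)`).** For every prime `p ≡ 4 (mod 9)`
with `3 ∉ 𝔽_p^{×3}` and all globally minimal `B ≅ E_p : x³ + y³ = p`, `A ≅ E_{3p²}`: the analytic Ш
orders are rational, `#Ш_an(B) = qB`, `#Ш_an(A) = qA`, `qB·qA ≠ 0`, and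
`ord₂ #Ш(B)[2^∞] + ord₂ #Ш(A)[2^∞] ≤ ord₂ (qB·qA)` — the coupled `2`-adic Kolyvagin (Euler-system)
inequality for Hu–Shu–Yin's Rankin-type product `L′(E_p,1)·L(E_{3p²},1)`. This is the CONCLUSION of
the cell's refereed paper theorem K3 (coupled McCallum structure theorem at `2` over `ℚ(ω)`:
`s_A + s_B = 2(m − M_{I*}) ≤ 2m = ord₂(qB·qA)`); it is stated fact-free and Euler-system-free so that a
stub `PublishedFactsTwoPlus → CoupledUpperBoundAtTwoFourModNine` displays exactly the paper theorem.
(`Nat.card` of an infinite group is `0`; under `PublishedFactsTwoPlus` both `2`-primary parts are finite,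
`finite_sha_two_pair`.) OPEN in the kernel; nothing asserted. [cite: HuShuYin2019, Cor. 4.4 and (bsd) p. 12]
[cite: McCallumLMS1991, Thm. 5.4] [cite: Kolyvagin1990, Thm. A] -/
@[conjecture] def CoupledUpperBoundAtTwoFourModNine : Prop :=
  ∀ (p : ℕ), p.Prime → p % 9 = 4 → (¬ ∃ x : ZMod p, x ^ 3 = 3) →
    ∀ (A B : WeierstrassCurve ℚ) [A.IsElliptic] [A.IsGloballyMinimal] [B.IsElliptic]
      [B.IsGloballyMinimal],
      (∃ C : VariableChange ℚ, C • B = cubeSumCurve (p : ℚ)) →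
      (∃ C : VariableChange ℚ, C • A = cubeSumCurve (3 * (p : ℚ) ^ 2)) →
      ∃ qB qA : ℚ, shaAn B = (qB : ℂ) ∧ shaAn A = (qA : ℂ) ∧ qB * qA ≠ 0 ∧
        (padicValNat 2 (Nat.card (AddCommGroup.primaryComponent B.sha 2)) : ℤ) +
            (padicValNat 2 (Nat.card (AddCommGroup.primaryComponent A.sha 2)) : ℤ) ≤
          padicValRat 2 (qB * qA)

/-! ## §2 Bookkeeping under the facts: finiteness, evenness of the right side -/

section Facts

variable {p : ℕ}

/-- Under `PublishedFactsTwoPlus` both `2`-primary parts in the pair are FINITE (`Ш(B)` finite from the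
Hu–Shu–Yin bundle, `Ш(A)[2^∞]` finite from the CM rank-`0` BSD triple), so the `Nat.card`s in
`CoupledUpperBoundAtTwoFourModNine` are honest orders. [cite: HuShuYin2019, Thm. 1.3 and p. 4]
[cite: BurungaleFlach2024, Thm. 1.1 and Cor. 2] -/
theorem finite_sha_two_pair (hF : PublishedFactsTwoPlus) (hp : p.Prime) (h4 : p % 9 = 4)
    (h3 : ¬ ∃ x : ZMod p, x ^ 3 = 3) (A B : WeierstrassCurve ℚ) [A.IsElliptic] [A.IsGloballyMinimal]
    [B.IsElliptic] [B.IsGloballyMinimal] (hB : ∃ C : VariableChange ℚ, C • B = cubeSumCurve (p : ℚ))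
    (hA : ∃ C : VariableChange ℚ, C • A = cubeSumCurve (3 * (p : ℚ) ^ 2)) :
    Finite (AddCommGroup.primaryComponent B.sha 2) ∧ Finite (AddCommGroup.primaryComponent A.sha 2) := by
  obtain ⟨⟨hHSY, hCM0, hmod, -⟩, -⟩ := hF
  obtain ⟨hfinB, hfinA, -⟩ := SylvesterTwoUpper.pair_shaAn_two hHSY hCM0 hmod hp (Or.inl h4) h3 A B hB hA
  haveI : Finite B.sha := hfinB
  exact ⟨inferInstance, hfinA⟩

/-- **The right side is even** on `p ≡ 4 (mod 9)`, from Hu–Shu–Yin's height display ALONE (conjunct 2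
of `PublishedFactsTwoPlus`): `ord₂(#Ш_an(B)·#Ш_an(A)) = 2n` with `n : ℕ` — x1b/bsd-cm-two's
`SylvesterTwoThmCAssembly.twoAdicPairHSY_of_heightDisplay_mod_nine_eq_four`, re-exported under this
file's binders (`n = m(p)`, the `2`-divisibility index of Hu–Shu–Yin's point, in the memo's currency).
[cite: HuShuYin2019, display (bsd) p. 12, p. 8] -/
theorem even_rhs_of_facts (hF : PublishedFactsTwoPlus) (hp : p.Prime) (h4 : p % 9 = 4)
    (h3 : ¬ ∃ x : ZMod p, x ^ 3 = 3) (A B : WeierstrassCurve ℚ) [A.IsElliptic] [A.IsGloballyMinimal]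
    [B.IsElliptic] [B.IsGloballyMinimal] (hB : ∃ C : VariableChange ℚ, C • B = cubeSumCurve (p : ℚ))
    (hA : ∃ C : VariableChange ℚ, C • A = cubeSumCurve (3 * (p : ℚ) ^ 2)) :
    ∃ qB qA : ℚ, shaAn B = (qB : ℂ) ∧ shaAn A = (qA : ℂ) ∧ qB * qA ≠ 0 ∧
      ∃ n : ℕ, padicValRat 2 (qB * qA) = 2 * n :=
  SylvesterTwoThmCAssembly.twoAdicPairHSY_of_heightDisplay_mod_nine_eq_four hF.2 p hp h4 h3 A B hB hA

end Facts

/-! ## §3 THE REDUCTION (and its converse): the typed `Prop` IS the `p ≡ 4 (mod 9)` slice of the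
upper half -/

/-- **K3R, the «last inch» as an iff.** Granted `PublishedFactsTwoPlus`:
`CoupledUpperBoundAtTwoFourModNine` holds iff every globally minimal `B ≅ E_p` with `p ≡ 4 (mod 9)`
prime, `3 ∉ 𝔽_p^{×3}`, satisfies the Euler-system half `MissingUpperBoundAt B 2`
(`ord₂ #Ш(B) ≤ ord₂ #Ш_an(B)`). (→: supply a minimal `A ≅ E_{3p²}` by Néron/Silverman VIII.8.3 and
cancel the partner's terms, `SylvesterTwoUpper.missingUpperBoundAt_iff_pairBound`; ←: the same iff
read backwards.) [cite: HuShuYin2019, Cor. 4.4 and (bsd) p. 12] [cite: BurungaleFlach2024, Thm. 1.1 and Cor. 2]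
[cite: Miller2011LMS, Def. 1.1] [cite: SilvermanAEC2009, VIII.8 Cor. 8.3] -/
theorem coupledUpperBound_iff_missingUpperBoundAt (hF : PublishedFactsTwoPlus) :
    CoupledUpperBoundAtTwoFourModNine ↔
      ∀ (p : ℕ), p.Prime → p % 9 = 4 → (¬ ∃ x : ZMod p, x ^ 3 = 3) →
        ∀ (B : WeierstrassCurve ℚ) [B.IsElliptic] [B.IsGloballyMinimal],
          (∃ C : VariableChange ℚ, C • B = cubeSumCurve (p : ℚ)) → MissingUpperBoundAt B 2 := by
  obtain ⟨⟨hHSY, hCM0, hmod, -⟩, -⟩ := hF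
  refine ⟨fun h p hp h4 h3 B _ _ hB => ?_, fun h p hp h4 h3 A B _ _ _ _ hB hA => ?_⟩
  · have hn : (3 * (p : ℚ) ^ 2) ≠ 0 :=
      mul_ne_zero (by norm_num) (pow_ne_zero _ (Nat.cast_ne_zero.mpr hp.ne_zero))
    haveI := X12.CubeSumFamilies.isElliptic_cubeSumCurve hn
    obtain ⟨A, _, _, CA, hCA⟩ :=
      X12.CubeSumFamilies.exists_isGloballyMinimal_model (cubeSumCurve (3 * (p : ℚ) ^ 2))
    exact (SylvesterTwoUpper.missingUpperBoundAt_iff_pairBound hHSY hCM0 hmod hp (Or.inl h4) h3 A B hB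
      ⟨CA, hCA⟩).mpr (h p hp h4 h3 A B hB ⟨CA, hCA⟩)
  · exact (SylvesterTwoUpper.missingUpperBoundAt_iff_pairBound hHSY hCM0 hmod hp (Or.inl h4) h3 A B hB
      hA).mp (h p hp h4 h3 B hB)

/-- **K3 ⇒ the upper half for every `p ≡ 4 (mod 9)` member** (all of them, on and off `𝒱₀`), granted
the facts. [cite: HuShuYin2019, Cor. 4.4 and (bsd) p. 12] [cite: Miller2011LMS, Def. 1.1] -/
theorem missingUpperBoundAt_two_of_coupledUpperBound (hF : PublishedFactsTwoPlus)
    (hK3 : CoupledUpperBoundAtTwoFourModNine) {p : ℕ} (hp : p.Prime) (h4 : p % 9 = 4)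
    (h3 : ¬ ∃ x : ZMod p, x ^ 3 = 3) (B : WeierstrassCurve ℚ) [B.IsElliptic] [B.IsGloballyMinimal]
    (hB : ∃ C : VariableChange ℚ, C • B = cubeSumCurve (p : ℚ)) : MissingUpperBoundAt B 2 :=
  (coupledUpperBound_iff_missingUpperBoundAt hF).mp hK3 p hp h4 h3 B hB

/-- **K3 in the memo's literal currency «`s_A + s_B ≤ 2m`».** Granted the facts,
`CoupledUpperBoundAtTwoFourModNine` holds iff for every `p ≡ 4 (mod 9)` member and partner there are the
rational analytic orders `qB, qA` and an `n : ℕ` with `ord₂(qB·qA) = 2n` and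
`ord₂ #Ш(B)[2^∞] + ord₂ #Ш(A)[2^∞] ≤ 2n` (the `n` is the display's, `= m(p)` in the memo; evenness by
`even_rhs_of_facts`, uniqueness of `#Ш_an`). [cite: HuShuYin2019, display (bsd) p. 12] -/
theorem coupledUpperBound_iff_le_two_mul (hF : PublishedFactsTwoPlus) :
    CoupledUpperBoundAtTwoFourModNine ↔
      ∀ (p : ℕ), p.Prime → p % 9 = 4 → (¬ ∃ x : ZMod p, x ^ 3 = 3) →
        ∀ (A B : WeierstrassCurve ℚ) [A.IsElliptic] [A.IsGloballyMinimal] [B.IsElliptic]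
          [B.IsGloballyMinimal],
          (∃ C : VariableChange ℚ, C • B = cubeSumCurve (p : ℚ)) →
          (∃ C : VariableChange ℚ, C • A = cubeSumCurve (3 * (p : ℚ) ^ 2)) →
          ∃ (qB qA : ℚ) (n : ℕ), shaAn B = (qB : ℂ) ∧ shaAn A = (qA : ℂ) ∧
            padicValRat 2 (qB * qA) = 2 * n ∧
            (padicValNat 2 (Nat.card (AddCommGroup.primaryComponent B.sha 2)) : ℤ) +
                (padicValNat 2 (Nat.card (AddCommGroup.primaryComponent A.sha 2)) : ℤ) ≤ 2 * n := by
  refine ⟨fun h p hp h4 h3 A B _ _ _ _ hB hA => ?_, fun h p hp h4 h3 A B _ _ _ _ hB hA => ?_⟩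
  · obtain ⟨qB, qA, hqB, hqA, hne, hle⟩ := h p hp h4 h3 A B hB hA
    obtain ⟨qB', qA', hqB', hqA', -, n, hn⟩ := even_rhs_of_facts hF hp h4 h3 A B hB hA
    have hqq : qB' = qB := by exact_mod_cast hqB'.symm.trans hqB
    have hqq' : qA' = qA := by exact_mod_cast hqA'.symm.trans hqA
    subst hqq hqq'
    exact ⟨qB', qA', n, hqB, hqA, hn, hn ▸ hle⟩
  · obtain ⟨qB, qA, n, hqB, hqA, hn, hle⟩ := h p hp h4 h3 A B hB hA
    obtain ⟨qB', qA', hqB', hqA', hne, -⟩ := even_rhs_of_facts hF hp h4 h3 A B hB hA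
    have hqq : qB' = qB := by exact_mod_cast hqB'.symm.trans hqB
    have hqq' : qA' = qA := by exact_mod_cast hqA'.symm.trans hqA
    subst hqq hqq'
    exact ⟨qB', qA', hqB, hqA, hne, hn ▸ hle⟩

/-! ## §4 The registered residual (OFFB) of VARIANT H, by residue class -/

/-- **K3 ⇒ VARIANT H's `stub_upperOffV0B_HSY` RESTRICTED to `p % 9 = 4`, VERBATIM** (the stub's
statement with the disjunct `p % 9 = 7` removed; its hypothesis `#Ш(B)[2^∞] ≠ 1` is carried but not
used — K3 covers the `𝒱₀` locus as well). This is the planner's (b)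
`PublishedFactsTwoPlus → CoupledUpperBoundAtTwoFourModNine → hoffB|_{p % 9 = 4}`.
[cite: HuShuYin2019, Cor. 4.4 and (bsd) p. 12] [cite: McCallumLMS1991, Thm. 5.4] -/
theorem upperOffV0B_fourModNine_of_coupledUpperBound (hK3 : CoupledUpperBoundAtTwoFourModNine) :
    PublishedFactsTwoPlus →
      ∀ (p : ℕ), p.Prime → p % 9 = 4 → (¬ ∃ x : ZMod p, x ^ 3 = 3) →
        ∀ (B : WeierstrassCurve ℚ) [B.IsElliptic] [B.IsGloballyMinimal],
          (∃ C : VariableChange ℚ, C • B = cubeSumCurve (p : ℚ)) →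
          Nat.card (AddCommGroup.primaryComponent B.sha 2) ≠ 1 → MissingUpperBoundAt B 2 :=
  fun hF _ hp h4 h3 B _ _ hB _ => missingUpperBoundAt_two_of_coupledUpperBound hF hK3 hp h4 h3 B hB

/-- **Splice of the two residue classes.** The residual (OFFB) restricted to `p % 9 = 4` and restricted
to `p % 9 = 7` together give VARIANT H's `stub_upperOffV0B_HSY` VERBATIM. Pure logic; recorded so a
VARIANT I skeleton can display the two halves as separate stubs (`p ≡ 4`: K3, paper; `p ≡ 7`:
research — the halved system, memo §64.7). [folklore] -/
theorem upperOffV0B_of_residues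
    (h4 : PublishedFactsTwoPlus →
      ∀ (p : ℕ), p.Prime → p % 9 = 4 → (¬ ∃ x : ZMod p, x ^ 3 = 3) →
        ∀ (B : WeierstrassCurve ℚ) [B.IsElliptic] [B.IsGloballyMinimal],
          (∃ C : VariableChange ℚ, C • B = cubeSumCurve (p : ℚ)) →
          Nat.card (AddCommGroup.primaryComponent B.sha 2) ≠ 1 → MissingUpperBoundAt B 2)
    (h7 : PublishedFactsTwoPlus →
      ∀ (p : ℕ), p.Prime → p % 9 = 7 → (¬ ∃ x : ZMod p, x ^ 3 = 3) →
        ∀ (B : WeierstrassCurve ℚ) [B.IsElliptic] [B.IsGloballyMinimal],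
          (∃ C : VariableChange ℚ, C • B = cubeSumCurve (p : ℚ)) →
          Nat.card (AddCommGroup.primaryComponent B.sha 2) ≠ 1 → MissingUpperBoundAt B 2) :
    PublishedFactsTwoPlus →
      ∀ (p : ℕ), p.Prime → (p % 9 = 4 ∨ p % 9 = 7) → (¬ ∃ x : ZMod p, x ^ 3 = 3) →
        ∀ (B : WeierstrassCurve ℚ) [B.IsElliptic] [B.IsGloballyMinimal],
          (∃ C : VariableChange ℚ, C • B = cubeSumCurve (p : ℚ)) →
          Nat.card (AddCommGroup.primaryComponent B.sha 2) ≠ 1 → MissingUpperBoundAt B 2 := by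
  intro hF p hp h9 h3 B _ _ hB hB1
  rcases h9 with h | h
  · exact h4 hF p hp h h3 B hB hB1
  · exact h7 hF p hp h h3 B hB hB1

/-- **VARIANT I composition preview** (nothing registered here): Yin's height display (Y), the derived
`2`-divisibility (C′), the typed K3 conclusion for `p ≡ 4 (mod 9)`, and ANY proof of the residual
(OFFB) on `p ≡ 7 (mod 9)` give the crux `UpperOffV0HSYPlus` BY NAME, through bsd-cm-two g8's landed
reduction `SylvesterTwoYin.upperOffV0HSYPlus_of_yin_of_offV0B`. Every antecedent is displayed; none is
claimed. [cite: HuShuYin2019, Cor. 4.4 and (bsd) p. 12] [cite: McCallumLMS1991, Thm. 5.4] -/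
theorem upperOffV0HSYPlus_of_coupledUpperBound (hY : SylvesterTwoYin.YinHeightDisplay)
    (hC : SylvesterTwoYin.YinPointTwoDivisibleSevenModNine) (hK3 : CoupledUpperBoundAtTwoFourModNine)
    (h7 : PublishedFactsTwoPlus →
      ∀ (p : ℕ), p.Prime → p % 9 = 7 → (¬ ∃ x : ZMod p, x ^ 3 = 3) →
        ∀ (B : WeierstrassCurve ℚ) [B.IsElliptic] [B.IsGloballyMinimal],
          (∃ C : VariableChange ℚ, C • B = cubeSumCurve (p : ℚ)) →
          Nat.card (AddCommGroup.primaryComponent B.sha 2) ≠ 1 → MissingUpperBoundAt B 2) :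
    UpperOffV0HSYPlus :=
  SylvesterTwoYin.upperOffV0HSYPlus_of_yin_of_offV0B hY hC
    (upperOffV0B_of_residues (upperOffV0B_fourModNine_of_coupledUpperBound hK3) h7)

/-- **The `p ≡ 4 (mod 9)` slice of the crux needs neither (Y) nor (C′):** granted the facts, K3's typed
conclusion alone gives `UpperOffV0HSYPlus`'s conclusion for every `p ≡ 4 (mod 9)` member (the crux's
shape with the disjunct `p % 9 = 7` removed). [cite: HuShuYin2019, Cor. 4.4 and (bsd) p. 12] -/
theorem upperOffV0HSYPlus_fourModNine_of_coupledUpperBound (hK3 : CoupledUpperBoundAtTwoFourModNine) :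
    PublishedFactsTwoPlus →
      ∀ (p : ℕ), p.Prime → p % 9 = 4 → (¬ ∃ x : ZMod p, x ^ 3 = 3) →
        ∀ (A B : WeierstrassCurve ℚ) [A.IsElliptic] [A.IsGloballyMinimal] [B.IsElliptic]
          [B.IsGloballyMinimal],
          (∃ C : VariableChange ℚ, C • B = cubeSumCurve (p : ℚ)) →
          (∃ C : VariableChange ℚ, C • A = cubeSumCurve (3 * (p : ℚ) ^ 2)) →
          ¬ (Nat.card (AddCommGroup.primaryComponent B.sha 2) = 1 ∧
              Nat.card (AddCommGroup.primaryComponent A.sha 2) = 1) →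
          MissingUpperBoundAt B 2 :=
  fun hF _ hp h4 h3 _ B _ _ _ _ hB _ _ => missingUpperBoundAt_two_of_coupledUpperBound hF hK3 hp h4 h3 B hB

end Summit.BirchSwinnertonDyer.BirchSwinnertonDyer.Theorems.SylvesterTwoCoupledUpperBound

end
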